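import Literature.Geometry.Lorentzian.AsymptoticallyFlatChart
import Literature.Geometry.Lorentzian.AsymptoticFlatnessChart
import Literature.Geometry.Manifold.BreathingDeformation
import HarnessLib

/-!
# Breathing immersions of a `3`-manifold supported in a coordinate ball of an asymptotically flat end

Plumbing for the "injectivity marker" of one-parameter families of initial data (topic
`Geometry/Lorentzian`; the construction is explicit, everything PROVED). Let `e : AFEnd X` be an
end of the `3`-manifold `X`, `z₀ ∈ ℝ³`, `r > 0` with `e.R + 2r < ‖z₀‖` (`BreathingData`: the closed
coordinate ball `closedBall z₀ (2r)` lies in the exterior region of the chart). Transport the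
breathing deformation `φ s` of `ℝ³` (`BreathingDeformation.lean`: `φ s z = z + s β(‖z−z₀‖²/r²)(z−z₀)`,
`= id` off `ball z₀ r`, `dφ_s(z₀) = (1 + s) id`) to `X` through the chart:

  `e.breathe z₀ r s x = Φₑ (φ s (coord x))` if `x ∈ e.U` and `coord x ∈ ball z₀ r`, `= x` otherwise.

For `|s| < 1`:
* `breathe_eq_self_of_not_mem` — `breathe s = id` off the compact set
  `K = Φₑ(closedBall z₀ (3r/4))`, in particular on every far region `e.far R₁`, `R₁ ≥ ‖z₀‖ + r`
  (`breathe_eq_self_of_mem_far`), and near every point outside `K`;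
* `contMDiff_breathe`, `contMDiff_uncurry_breathe` — `breathe s` is smooth, jointly in `(s, x)` on
  `(−1, 1) × X`; `breathe_zero` — `breathe 0 = id`;
* `breathe_center`, `mfderiv_breathe_center` — the centre `x₀ = Φₑ z₀` is fixed and
  **`d(breathe s)(x₀) = (1 + s) • id`**;
* `exists_forall_injective_mfderiv_breathe` — for `|s|` small every differential of `breathe s`
  is injective (so initial data can be pulled back along it, `InitialDataSet.comap`).

Pulling an initial data set `d` back along `breathe s` changes it only inside `K` and multiplies
`h_{x₀}` by `(1 + s)²`: this is the device making gluing families injective in the parameter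
without moving the data near infinity. Standard differential topology (Lee 2013, Ch. 2).

## References

* J. M. Lee, *Introduction to Smooth Manifolds*, 2nd ed. (2013), Ch. 2, Prop. 2.25.
  [LeeSmoothManifolds2013]
* R. Bartnik, *The mass of an asymptotically flat manifold*, CPAM 39 (1986), §1. [Bartnik1986]
-/

noncomputable section

open Bundle Set Filter TopologicalSpace Metric Function
open scoped Manifold ContDiff Topology
open Literature.Geometry.Manifold

namespace Literature.Geometry.Lorentzian

namespace AFEnd

variable {X : Type} [TopologicalSpace X] [ChartedSpace E3 X] (e : AFEnd X) {z₀ : E3} {r : ℝ}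

/-- **The hypotheses of the breathing construction**: `r > 0` and the closed coordinate ball
`closedBall z₀ (2r)` lies in the exterior region `{e.R < ‖z‖}` of the chart. [cite: Bartnik1986, §1] -/
structure BreathingData (e : AFEnd X) (z₀ : E3) (r : ℝ) : Prop where
  r_pos : 0 < r
  lt_norm : e.R + 2 * r < ‖z₀‖

namespace BreathingData

variable {e} (B : BreathingData e z₀ r)
include B

/-- Points of `ball z₀ (2r)` lie in the exterior region. [folklore] -/
theorem R_lt_norm_of_mem_ball {z : E3} (hz : z ∈ ball z₀ (2 * r)) : e.R < ‖z‖ := by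
  rw [mem_ball, dist_eq_norm] at hz
  have h := norm_sub_norm_le z₀ z
  rw [← norm_neg (z₀ - z), neg_sub] at h
  linarith [B.lt_norm]

/-- For `|s| < 1`, `φ s` maps `ball z₀ r` into the exterior region. [folklore] -/
theorem R_lt_norm_phi {s : ℝ} (hs : |s| < 1) {z : E3} (hz : z ∈ ball z₀ r) :
    e.R < ‖Breathing.phi z₀ r s z‖ := by
  refine B.R_lt_norm_of_mem_ball (ball_subset_ball ?_ (Breathing.phi_mem_ball z₀ r hz s))
  nlinarith [B.r_pos, abs_nonneg s]

/-- `e.R < ‖z₀‖`. [folklore] -/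
theorem R_lt_norm_center : e.R < ‖z₀‖ :=
  B.R_lt_norm_of_mem_ball (mem_ball_self (by linarith [B.r_pos]))

end BreathingData

/-! ### The breathing map -/

open scoped Classical in
/-- **The breathing map** `breathe s : X → X`: `Φₑ ∘ φ s ∘ coord` on the coordinate ball
`{x ∈ U | coord x ∈ ball z₀ r}`, the identity elsewhere. [cite: LeeSmoothManifolds2013, Prop. 2.25] -/
def breathe (e : AFEnd X) (z₀ : E3) (r s : ℝ) (x : X) : X :=
  if x ∈ e.U ∧ e.coord x ∈ ball z₀ r then e.dataChartExt (Breathing.phi z₀ r s (e.coord x)) else x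

/-- The coordinate ball `{x ∈ U | coord x ∈ ball z₀ r}` (the carrier of the deformation). [folklore] -/
def breatheCarrier (e : AFEnd X) (z₀ : E3) (r : ℝ) : Set X := {x | x ∈ e.U ∧ e.coord x ∈ ball z₀ r}

/-- The carrier is open. [folklore] -/
theorem isOpen_breatheCarrier (e : AFEnd X) (z₀ : E3) (r : ℝ) : IsOpen (e.breatheCarrier z₀ r) :=
  ContinuousOn.isOpen_inter_preimage (fun _ hq ↦ (e.contMDiffAt_coord hq).continuousAt.continuousWithinAt)
    e.U.isOpen isOpen_ball

/-- On the carrier, `breathe s x = Φₑ (φ s (coord x))`. [folklore] -/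
theorem breathe_of_mem {s : ℝ} {x : X} (hx : x ∈ e.breatheCarrier z₀ r) :
    e.breathe z₀ r s x = e.dataChartExt (Breathing.phi z₀ r s (e.coord x)) := by
  classical
  exact if_pos hx

/-- Off the carrier, `breathe s x = x`. [folklore] -/
theorem breathe_of_not_mem {s : ℝ} {x : X} (hx : x ∉ e.breatheCarrier z₀ r) : e.breathe z₀ r s x = x := by
  classical
  exact if_neg hx

/-- `breathe 0 = id` (`φ 0 = id` and `Φₑ (coord x) = x` on the end). [folklore] -/
theorem breathe_zero (x : X) : e.breathe z₀ r 0 x = x := by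
  by_cases hx : x ∈ e.breatheCarrier z₀ r
  · rw [e.breathe_of_mem hx, Breathing.phi_zero, id_eq, e.dataChartExt_of_lt (e.lt_norm_coord hx.1),
      e.dataChart_coord hx.1]
  · exact e.breathe_of_not_mem hx

/-- `breathe 0 = id` as functions. [folklore] -/
@[simp] theorem breathe_zero_eq : e.breathe z₀ r 0 = id := funext (e.breathe_zero)

variable {e} (B : BreathingData e z₀ r)

/-- The **moved set** `K = Φₑ (closedBall z₀ (3r/4))`: compact, contained in the carrier, and
`breathe s` is the identity off `K`. [folklore] -/
def breatheCore (e : AFEnd X) (z₀ : E3) (r : ℝ) : Set X :=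
  e.dataChartExt '' closedBall z₀ (3 * r / 4)

include B in
/-- `K` is compact. [folklore] -/
theorem isCompact_breatheCore : IsCompact (breatheCore e z₀ r) := by
  have hsub : closedBall z₀ (3 * r / 4) ⊆ {z : E3 | e.R < ‖z‖} := fun z hz ↦
    B.R_lt_norm_of_mem_ball (closedBall_subset_ball (by linarith [B.r_pos]) hz)
  refine (isCompact_closedBall z₀ (3 * r / 4)).image_of_continuousOn fun z hz ↦ ?_
  exact (e.contMDiffAt_dataChartExt (hsub hz)).continuousAt.continuousWithinAt

include B in
/-- `K ⊆ carrier`. [folklore] -/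
theorem breatheCore_subset_carrier : breatheCore e z₀ r ⊆ e.breatheCarrier z₀ r := by
  rintro _ ⟨z, hz, rfl⟩
  have hzR : e.R < ‖z‖ := B.R_lt_norm_of_mem_ball (closedBall_subset_ball (by linarith [B.r_pos]) hz)
  refine ⟨?_, ?_⟩
  · rw [e.dataChartExt_of_lt hzR]
    exact (e.chart.symm ⟨z, hzR⟩).2
  · rw [e.dataChartExt_of_lt hzR, e.coord_dataChart]
    exact closedBall_subset_ball (by linarith [B.r_pos]) hz

include B in
/-- Points of `K` have coordinate norm `≤ ‖z₀‖ + 3r/4`. [folklore] -/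
theorem norm_coord_le_of_mem_breatheCore {x : X} (hx : x ∈ breatheCore e z₀ r) : ‖e.coord x‖ ≤ ‖z₀‖ + 3 * r / 4 := by
  obtain ⟨z, hz, rfl⟩ := hx
  have hzR : e.R < ‖z‖ := B.R_lt_norm_of_mem_ball (closedBall_subset_ball (by linarith [B.r_pos]) hz)
  rw [e.dataChartExt_of_lt hzR, e.coord_dataChart]
  rw [mem_closedBall, dist_eq_norm] at hz
  have h := norm_le_norm_add_norm_sub' z z₀
  have h' : ‖z‖ ≤ ‖z₀‖ + ‖z - z₀‖ := by
    have := norm_le_insert' z z₀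
    linarith [norm_sub_rev z z₀]
  linarith

include B in
/-- **`breathe s` is the identity off `K`.** [cite: LeeSmoothManifolds2013, Prop. 2.25] -/
theorem breathe_eq_self_of_not_mem_core {s : ℝ} {x : X} (hx : x ∉ breatheCore e z₀ r) :
    e.breathe z₀ r s x = x := by
  by_cases hxc : x ∈ e.breatheCarrier z₀ r
  · rw [e.breathe_of_mem hxc]
    -- `coord x ∉ closedBall z₀ (3r/4)`, else `x = Φₑ (coord x) ∈ K`
    have hnot : e.coord x ∉ closedBall z₀ (3 * r / 4) := by
      intro hmem
      apply hx
      refine ⟨e.coord x, hmem, ?_⟩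
      rw [e.dataChartExt_of_lt (e.lt_norm_coord hxc.1), e.dataChart_coord hxc.1]
    have hge : r ^ 2 / 2 ≤ ‖e.coord x - z₀‖ ^ 2 := by
      rw [mem_closedBall, dist_eq_norm, not_le] at hnot
      have h1 : (3 * r / 4) ^ 2 ≤ ‖e.coord x - z₀‖ ^ 2 :=
        pow_le_pow_left₀ (by linarith [B.r_pos]) hnot.le 2
      nlinarith [B.r_pos]
    rw [Breathing.phi_eq_self_of z₀ r B.r_pos hge, e.dataChartExt_of_lt (e.lt_norm_coord hxc.1),
      e.dataChart_coord hxc.1]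
  · exact e.breathe_of_not_mem hxc

include B in
/-- `breathe s` is eventually the identity near every point outside `K`. [folklore] -/
theorem breathe_eventuallyEq_id_of_not_mem_core [T2Space X] {s : ℝ} {x : X} (hx : x ∉ breatheCore e z₀ r) :
    e.breathe z₀ r s =ᶠ[𝓝 x] id := by
  filter_upwards [(isCompact_breatheCore B).isClosed.isOpen_compl.mem_nhds hx] with y hy
  exact breathe_eq_self_of_not_mem_core B hy

include B in
/-- **Far regions are not moved**: `K ∩ e.far R₁ = ∅` for `R₁ ≥ ‖z₀‖ + r`, hence `breathe s = id`
on `e.far R₁`. [cite: Bartnik1986, §1] -/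
theorem breathe_eq_self_of_mem_far {R₁ : ℝ} (hR₁ : ‖z₀‖ + r ≤ R₁) {s : ℝ} {x : X} (hx : x ∈ e.far R₁) :
    e.breathe z₀ r s x = x := by
  refine breathe_eq_self_of_not_mem_core B fun hK ↦ ?_
  have h1 := norm_coord_le_of_mem_breatheCore B hK
  obtain ⟨_, h2⟩ := e.mem_far_iff_coord.1 hx
  linarith [B.r_pos]

include B in
/-- Points of `K` do not lie in `e.far R₁` for `R₁ ≥ ‖z₀‖ + r`. [cite: Bartnik1986, §1] -/
theorem not_mem_far_of_mem_core {R₁ : ℝ} (hR₁ : ‖z₀‖ + r ≤ R₁) {x : X} (hx : x ∈ breatheCore e z₀ r) :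
    x ∉ e.far R₁ := fun hfar ↦ by
  have h1 := norm_coord_le_of_mem_breatheCore B hx
  obtain ⟨_, h2⟩ := e.mem_far_iff_coord.1 hfar
  linarith [B.r_pos]

/-! ### Values on the carrier -/

include B in
/-- On the carrier (`|s| < 1`): `breathe s x ∈ U` and `coord (breathe s x) = φ s (coord x)`.
[folklore] -/
theorem breathe_mem_and_coord {s : ℝ} (hs : |s| < 1) {x : X} (hx : x ∈ e.breatheCarrier z₀ r) :
    e.breathe z₀ r s x ∈ e.U ∧ e.coord (e.breathe z₀ r s x) = Breathing.phi z₀ r s (e.coord x) := by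
  have hR : e.R < ‖Breathing.phi z₀ r s (e.coord x)‖ := B.R_lt_norm_phi hs hx.2
  rw [e.breathe_of_mem hx, e.dataChartExt_of_lt hR]
  exact ⟨(e.chart.symm ⟨_, hR⟩).2, e.coord_dataChart _⟩

include B in
/-- The centre `x₀ = Φₑ z₀` lies on the carrier, with `coord x₀ = z₀`. [folklore] -/
theorem center_mem : e.dataChartExt z₀ ∈ e.breatheCarrier z₀ r ∧ e.coord (e.dataChartExt z₀) = z₀ := by
  have hR := B.R_lt_norm_center
  rw [e.dataChartExt_of_lt hR]
  refine ⟨⟨(e.chart.symm ⟨z₀, hR⟩).2, ?_⟩, e.coord_dataChart _⟩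
  rw [e.coord_dataChart]
  exact mem_ball_self B.r_pos

include B in
/-- **The centre is fixed**: `breathe s x₀ = x₀`. [cite: LeeSmoothManifolds2013, Prop. 2.25] -/
theorem breathe_center (s : ℝ) : e.breathe z₀ r s (e.dataChartExt z₀) = e.dataChartExt z₀ := by
  obtain ⟨hmem, hcoord⟩ := center_mem B
  rw [e.breathe_of_mem hmem, hcoord, Breathing.phi_apply_center]

/-! ### Smoothness -/

include B in
/-- The chart formula `x ↦ Φₑ (φ s (coord x))` is smooth at points of the carrier, jointly in
`(s, x)` on `(−1, 1) × carrier`. [folklore] -/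
theorem contMDiffAt_formula {p : ℝ × X} (hs : |p.1| < 1) (hx : p.2 ∈ e.breatheCarrier z₀ r) :
    ContMDiffAt (𝓘(ℝ, ℝ).prod (𝓡 3)) (𝓡 3) ∞
      (fun q : ℝ × X ↦ e.dataChartExt (Breathing.phi z₀ r q.1 (e.coord q.2))) p := by
  have hcoord : ContMDiffAt (𝓘(ℝ, ℝ).prod (𝓡 3)) 𝓘(ℝ, E3) ∞ (fun q : ℝ × X ↦ e.coord q.2) p :=
    (e.contMDiffAt_coord hx.1).comp p contMDiffAt_snd
  have hphi : ContMDiffAt (𝓘(ℝ, ℝ).prod (𝓡 3)) 𝓘(ℝ, E3) ∞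
      (fun q : ℝ × X ↦ Breathing.phi z₀ r q.1 (e.coord q.2)) p :=
    (Breathing.contDiff_uncurry_phi z₀ r (n := ⊤)).contDiffAt.comp_contMDiffAt
      (contMDiffAt_fst.prodMk_space hcoord)
  exact (e.contMDiffAt_dataChartExt (B.R_lt_norm_phi hs hx.2)).comp p hphi

include B in
/-- **`(s, x) ↦ breathe s x` is smooth on `(−1, 1) × X`.** [cite: LeeSmoothManifolds2013, Prop. 2.25] -/
theorem contMDiffAt_uncurry_breathe [T2Space X] {p : ℝ × X} (hs : |p.1| < 1) :
    ContMDiffAt (𝓘(ℝ, ℝ).prod (𝓡 3)) (𝓡 3) ∞ (uncurry (e.breathe z₀ r)) p := by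
  by_cases hx : p.2 ∈ e.breatheCarrier z₀ r
  · refine (contMDiffAt_formula B hs hx).congr_of_eventuallyEq ?_
    have hev : ∀ᶠ q : ℝ × X in 𝓝 p, q.2 ∈ e.breatheCarrier z₀ r :=
      (continuousAt_snd (p := p)).preimage_mem_nhds ((e.isOpen_breatheCarrier z₀ r).mem_nhds hx)
    filter_upwards [hev] with q hq
    exact e.breathe_of_mem hq
  · have hK : p.2 ∉ breatheCore e z₀ r := fun h ↦ hx (breatheCore_subset_carrier B h)
    refine (contMDiffAt_snd (p := p)).congr_of_eventuallyEq ?_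
    have hev : ∀ᶠ q : ℝ × X in 𝓝 p, q.2 ∉ breatheCore e z₀ r :=
      (continuousAt_snd (p := p)).preimage_mem_nhds
        ((isCompact_breatheCore B).isClosed.isOpen_compl.mem_nhds hK)
    filter_upwards [hev] with q hq
    exact breathe_eq_self_of_not_mem_core B hq

include B in
/-- **`breathe s` is smooth** for `|s| < 1`. [cite: LeeSmoothManifolds2013, Prop. 2.25] -/
theorem contMDiff_breathe [T2Space X] {s : ℝ} (hs : |s| < 1) : ContMDiff (𝓡 3) (𝓡 3) ∞ (e.breathe z₀ r s) := by
  intro x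
  have h := contMDiffAt_uncurry_breathe B (p := (s, x)) hs
  exact h.comp x ((contMDiffAt_const (c := s)).prodMk contMDiffAt_id)

include B in
/-- `breathe s` is smooth in the degree `∞ + 1` required by pullbacks of data. [folklore] -/
theorem contMDiff_breathe_succ [T2Space X] {s : ℝ} (hs : |s| < 1) :
    ContMDiff (𝓡 3) (𝓡 3) (∞ + 1) (e.breathe z₀ r s) := contMDiff_breathe B hs

/-! ### Differentials -/

/-- The differential of `coord` at a point of the end is injective (`dΦₑ ∘ dchart = id`). [folklore] -/
theorem injective_mfderiv_coord (e : AFEnd X) {x : X} (hx : x ∈ e.U) :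
    Injective (mfderiv (𝓡 3) 𝓘(ℝ, E3) e.coord x) := by
  intro v w hvw
  have hv := e.mfderiv_dataChart_mfderiv_chart ⟨x, hx⟩ v
  have hw := e.mfderiv_dataChart_mfderiv_chart ⟨x, hx⟩ w
  rw [← e.mfderiv_coord_comp_val ⟨x, hx⟩] at hv hw
  rw [← hv, ← hw]
  exact congrArg _ hvw

/-- The differential of `dataChartExt` at a point of the exterior region is injective. [folklore] -/
theorem injective_mfderiv_dataChartExt (e : AFEnd X) {z : E3} (hz : e.R < ‖z‖) :
    Injective (mfderiv 𝓘(ℝ, E3) (𝓡 3) e.dataChartExt z) := by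
  intro v w hvw
  apply e.injective_mfderiv_dataChart ⟨z, hz⟩
  rw [e.mfderiv_dataChart_eq, e.mfderiv_dataChart_eq]
  exact hvw

include B in
/-- **Chain rule on the carrier**: for `|s| < 1` and `x` on the carrier,
`d(breathe s)_x = dΦₑ ∘ dφ_s ∘ dcoord`. [folklore] -/
theorem mfderiv_breathe_of_mem [T2Space X] {s : ℝ} (hs : |s| < 1) {x : X} (hx : x ∈ e.breatheCarrier z₀ r)
    (v : TangentSpace (𝓡 3) x) :
    mfderiv (𝓡 3) (𝓡 3) (e.breathe z₀ r s) x v =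
      mfderiv 𝓘(ℝ, E3) (𝓡 3) e.dataChartExt (Breathing.phi z₀ r s (e.coord x))
        (fderiv ℝ (Breathing.phi z₀ r s) (e.coord x) (mfderiv (𝓡 3) 𝓘(ℝ, E3) e.coord x v)) := by
  have hev : e.breathe z₀ r s =ᶠ[𝓝 x] fun y ↦ e.dataChartExt (Breathing.phi z₀ r s (e.coord y)) := by
    filter_upwards [(e.isOpen_breatheCarrier z₀ r).mem_nhds hx] with y hy
    exact e.breathe_of_mem hy
  rw [hev.mfderiv_eq]
  have hc : MDifferentiableAt (𝓡 3) 𝓘(ℝ, E3) e.coord x := (e.contMDiffAt_coord hx.1).mdifferentiableAt (by simp)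
  have hφd : DifferentiableAt ℝ (Breathing.phi z₀ r s) (e.coord x) :=
    (Breathing.contDiff_phi z₀ r s (n := 1)).differentiable one_ne_zero _
  have hφ : MDifferentiableAt 𝓘(ℝ, E3) 𝓘(ℝ, E3) (Breathing.phi z₀ r s) (e.coord x) :=
    hφd.mdifferentiableAt
  have hd : MDifferentiableAt 𝓘(ℝ, E3) (𝓡 3) e.dataChartExt (Breathing.phi z₀ r s (e.coord x)) :=
    (e.contMDiffAt_dataChartExt (B.R_lt_norm_phi hs hx.2)).mdifferentiableAt (by simp)
  have h1 : mfderiv (𝓡 3) (𝓡 3) (fun y ↦ e.dataChartExt (Breathing.phi z₀ r s (e.coord y))) x =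
      (mfderiv 𝓘(ℝ, E3) (𝓡 3) e.dataChartExt (Breathing.phi z₀ r s (e.coord x))).comp
        (mfderiv (𝓡 3) 𝓘(ℝ, E3) (fun y ↦ Breathing.phi z₀ r s (e.coord y)) x) :=
    mfderiv_comp x hd (hφ.comp x hc)
  have h2 : mfderiv (𝓡 3) 𝓘(ℝ, E3) (fun y ↦ Breathing.phi z₀ r s (e.coord y)) x =
      (mfderiv 𝓘(ℝ, E3) 𝓘(ℝ, E3) (Breathing.phi z₀ r s) (e.coord x)).comp
        (mfderiv (𝓡 3) 𝓘(ℝ, E3) e.coord x) :=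
    mfderiv_comp x hφ hc
  rw [h1, h2, mfderiv_eq_fderiv]
  rfl

include B in
/-- **The differentials of `breathe s` are injective for small `|s|`**: on the carrier they are
`dΦₑ ∘ dφ_s ∘ dcoord` (three injective maps, `exists_forall_injective_fderiv_phi`), off the
moved set `breathe s` is locally the identity. [cite: LeeSmoothManifolds2013, Prop. 2.25] -/
theorem exists_forall_injective_mfderiv_breathe [T2Space X] :
    ∃ s₀ : ℝ, 0 < s₀ ∧ s₀ ≤ 1 ∧ ∀ s : ℝ, |s| < s₀ →
      ∀ x : X, Injective (mfderiv (𝓡 3) (𝓡 3) (e.breathe z₀ r s) x) := by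
  obtain ⟨s₁, hs₁, hinj⟩ := Breathing.exists_forall_injective_fderiv_phi z₀ r B.r_pos
  refine ⟨min s₁ 1, lt_min hs₁ one_pos, min_le_right _ _, fun s hs x ↦ ?_⟩
  have hs' : |s| < 1 := lt_of_lt_of_le hs (min_le_right _ _)
  have hs'' : |s| < s₁ := lt_of_lt_of_le hs (min_le_left _ _)
  by_cases hx : x ∈ e.breatheCarrier z₀ r
  · intro v w hvw
    rw [mfderiv_breathe_of_mem B hs' hx, mfderiv_breathe_of_mem B hs' hx] at hvw
    exact e.injective_mfderiv_coord hx.1 (hinj s hs'' _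
      (e.injective_mfderiv_dataChartExt (B.R_lt_norm_phi hs' hx.2) hvw))
  · have hK : x ∉ breatheCore e z₀ r := fun h ↦ hx (breatheCore_subset_carrier B h)
    rw [(breathe_eventuallyEq_id_of_not_mem_core B (s := s) hK).mfderiv_eq, mfderiv_id]
    exact fun v w h ↦ h

include B in
/-- Off the moved set the differential of `breathe s` is the identity. [folklore] -/
theorem mfderiv_breathe_of_not_mem_core [T2Space X] {s : ℝ} {x : X} (hx : x ∉ breatheCore e z₀ r) :
    mfderiv (𝓡 3) (𝓡 3) (e.breathe z₀ r s) x = ContinuousLinearMap.id ℝ (TangentSpace (𝓡 3) x) := by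
  rw [(breathe_eventuallyEq_id_of_not_mem_core B (s := s) hx).mfderiv_eq, mfderiv_id]

include B in
/-- **Breathing at the centre**: `d(breathe s)(x₀) = (1 + s) • id` for `|s| < 1`, `x₀ = Φₑ z₀`
(`dφ_s(z₀) = (1 + s) id` and `dΦₑ ∘ dcoord = id` on the end). [cite: LeeSmoothManifolds2013, Prop. 2.25] -/
theorem mfderiv_breathe_center [T2Space X] {s : ℝ} (hs : |s| < 1) (v : TangentSpace (𝓡 3) (e.dataChartExt z₀)) :
    mfderiv (𝓡 3) (𝓡 3) (e.breathe z₀ r s) (e.dataChartExt z₀) v = (1 + s) • v := by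
  obtain ⟨hmem, hcoord⟩ := center_mem B
  rw [mfderiv_breathe_of_mem B hs hmem, hcoord, Breathing.fderiv_phi_center z₀ r B.r_pos,
    Breathing.phi_apply_center]
  -- `dΦₑ (dcoord v) = v` at `x₀`
  have key : mfderiv 𝓘(ℝ, E3) (𝓡 3) e.dataChartExt z₀ (mfderiv (𝓡 3) 𝓘(ℝ, E3) e.coord (e.dataChartExt z₀) v) = v := by
    have hq : e.dataChartExt z₀ ∈ e.U := hmem.1
    have h := e.mfderiv_dataChart_mfderiv_chart ⟨e.dataChartExt z₀, hq⟩ v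
    rw [← e.mfderiv_coord_comp_val ⟨e.dataChartExt z₀, hq⟩, e.mfderiv_dataChart_eq] at h
    have hz : ((e.chart ⟨e.dataChartExt z₀, hq⟩ : exteriorRegion e.R) : E3) = z₀ := by
      rw [← e.coord_of_mem hq]; exact hcoord
    rw [hz] at h
    exact h
  exact ((mfderiv 𝓘(ℝ, E3) (𝓡 3) e.dataChartExt z₀).map_smul (1 + s) _).trans
    (congrArg (fun u : TangentSpace (𝓡 3) (e.dataChartExt z₀) ↦ (1 + s) • u) key)

end AFEnd

end Literature.Geometry.Lorentzian

end
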